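import Summits.PneNP.PneNP.Theorems.ConvexRankGatesLinAlgGateBlindGRankChainCover
import Summits.PneNP.PneNP.Theorems.ConvexRankGatesLinAlgGateBlindLogWidthDoors
import Summits.PneNP.PneNP.Theorems.ConvexRankGatesLinAlgGateBlindLevelHost

/-!
# Route ConvexRankGates, crux `LinAlgGateBlind` (stmt-PneNP-10681): the GRANK door at logarithmic width and the unconditional lower bound for `{∧₂, ∨₂} ∪ PERM_d ∪ GRANK_s`

Support theorems for the crux (vocabulary of `Theorems/ConvexRankGatesLinAlgGateBlindDefs.lean`). The span cover
`sgAt_gRank_of_chain_budget` (`…GRankChainCover`: the rejection region of a `GRANK_s` term gate over ANY field is covered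
by `≤ #𝒱(l)^{s²}` all-off events) at the logarithmic atom width `L(c,m) = (2c+8)(⌊log₂ m⌋+1)` of `…LogWidthPerm`, with
the common bookkeeping `logWidth_common` (`…LogWidthDoors`), gives

* `sgAt_gRank_logWidth` — for every `c`, eventually in `m`, for EVERY `s` with `s² ≤ m^{7/8}/(log₂ m)^5`:
  `SGAt m (GRANK_s) L (kOf m) (qOf m) (epsOf c m)` — the first single-gate statement on the GRANK side of the crux
  (fields, characteristics and constants unrestricted; only the dimension is bounded);
* `not_computes_clique_of_isOver_gRank_logWidth` — by the level-`l` door theorem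
  (`not_computes_clique_of_collapse_level`, `…LevelHost`; collapse `GRANK ∘ OR ⊆ GRANK` by `stub_termCollapse`):
  NO circuit over `{∧₂, ∨₂} ∪ GRANK_s`, `s² ≤ m^{7/8}/(log₂ m)^5`, with `≤ m^c` gates computes `CLIQUE(m, ⌈m^{1/8}⌉)`;
* `not_computes_clique_of_isOver_perm_gRank_logWidth` — the same over the crux's full wide basis
  `{∧₂, ∨₂} ∪ PERM_d ∪ GRANK_s` for `d log₂ d ≤ m^{7/8}/(log₂ m)^5` and `s² ≤ m^{7/8}/(log₂ m)^5` (`sgAt_or`: the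
  single-gate statement for a union of classes is the conjunction);
* `not_computes_clique_of_isOver_lin_rpow` — THE CRUX'S OWN SHAPE WITH A REAL GATE EXPONENT: for every `c` and every
  `γ < 7/16`, eventually in `m`, no circuit over `{∧₂, ∨₂} ∪ PERM_{⌊m^γ⌋} ∪ GRANK_{⌊m^γ⌋}` with `≤ m^c` gates computes
  `CLIQUE(m, ⌈m^{1/8}⌉)`. The crux `LinAlgGateBlind` asks this with `⌊m^γ⌋` replaced by `m^c` for every natural `c`
  (and is then Valiant-hard, `dcPerSuperpolynomial_of_linAlgGateBlind`); decoupling the gate parameter from the size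
  exponent, it holds unconditionally below `γ = 7/16` (GRANK) and `γ = 7/8` (PERM alone,
  `not_computes_clique_of_isOver_perm_logWidth`).

Sources: Razborov 1985, Alon–Boppana 1987 §3; Edmonds 1967 §5 Thm. 1; host, planting theorem and covers are the tree's.
No new definitions. [folklore]
-/

-- `Summit.PneNP.PneNP.…` duplicates `PneNP` BY DESIGN (single-problem summit).
set_option linter.dupNamespace false

noncomputable section

namespace Summit.PneNP.PneNP.Theorems

open Finset Filter Literature.Computability.Complexity Razborov
open Summit.PneNP.PneNP.Cruxes.LinAlgGateBlind.DnfInvariantWideGatesSeeSmallCliques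
open Summit.PneNP.PneNP.Cruxes.LinAlgGateBlind.DnfInvariantWideGatesSeeSmallCliques.DenseRegime

/-! ### SG_GRANK at logarithmic width for all `s² ≤ m^{7/8}/(log₂ m)^5` -/

/-- **`SGAt` for GRANK gates of dimension `s` with `s² ≤ m^{7/8}/(log₂ m)^5`, over any field** (finite or not, any
characteristic, any constants), at the logarithmic width `L(c,m) = (2c+8)(⌊log₂ m⌋+1)`, at every level `c`, eventually in
`m`: the span cover `sgAt_gRank_of_chain_budget` with the budgets of `logWidth_common` at `T = Λ·L·(s²+1)` and the cover
budget `#𝒱(L)^{s²} 2^{-(ν+1)} #𝒱(L) < ε` (`cover_budget_two_pow`, `#𝒱(L) ≤ 2^{ΛL}`). [folklore] -/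
theorem sgAt_gRank_logWidth : ∀ c : ℕ, ∀ᶠ m : ℕ in atTop, ∀ s : ℕ,
    (s : ℝ) ^ 2 ≤ (m : ℝ) ^ (7 / 8 : ℝ) / Real.logb 2 m ^ 5 →
      SGAt m (IsGRankGate s) ((2 * c + 8) * (Nat.log 2 m + 1)) (kOf m) (qOf m) (epsOf c m) := by
  intro c
  filter_upwards [logWidth_common c] with m hm s hs
  have hT : ((((Nat.log 2 m + 1) * ((2 * c + 8) * (Nat.log 2 m + 1)) * (s * s + 1) : ℕ) : ℝ)) ≤
      16 * ((c : ℝ) + 4) * Real.logb 2 m ^ 2 * ((m : ℝ) ^ (7 / 8 : ℝ) / Real.logb 2 m ^ 5) := by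
    obtain ⟨-, -, -, -, -, -, -, -, -, -, hℓ1, h5, hΛL⟩ := hm 0 (by
      push_cast
      exact mul_nonneg (mul_nonneg (by positivity) (sq_nonneg _))
        (div_nonneg (Real.rpow_nonneg (Nat.cast_nonneg m) _) (pow_nonneg (logb_two_nonneg m) 5)))
    have hβ1 : 1 ≤ (m : ℝ) ^ (7 / 8 : ℝ) / Real.logb 2 m ^ 5 := by
      rw [le_div_iff₀ (by positivity), one_mul]; exact h5
    have hs' : (s : ℝ) * s ≤ (m : ℝ) ^ (7 / 8 : ℝ) / Real.logb 2 m ^ 5 := by rw [← sq]; exact hs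
    have hD1 : ((s : ℝ) * s + 1) ≤ 2 * ((m : ℝ) ^ (7 / 8 : ℝ) / Real.logb 2 m ^ 5) := by linarith
    push_cast
    have h0 : (0 : ℝ) ≤ ((Nat.log 2 m : ℝ) + 1) * ((2 * (c : ℝ) + 8) * ((Nat.log 2 m : ℝ) + 1)) := by positivity
    calc ((Nat.log 2 m : ℝ) + 1) * ((2 * (c : ℝ) + 8) * ((Nat.log 2 m : ℝ) + 1)) * ((s : ℝ) * s + 1)
        ≤ (8 * ((c : ℝ) + 4) * Real.logb 2 m ^ 2) * (2 * ((m : ℝ) ^ (7 / 8 : ℝ) / Real.logb 2 m ^ 5)) :=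
          mul_le_mul hΛL hD1 (by positivity) (by positivity)
      _ = 16 * ((c : ℝ) + 4) * Real.logb 2 m ^ 2 * ((m : ℝ) ^ (7 / 8 : ℝ) / Real.logb 2 m ^ 5) := by ring
  obtain ⟨hm1, hq0, hq1, hhalf, hε, h2t, -, hpos, hB, hmΛ, -, -, -⟩ := hm _ hT
  refine sgAt_gRank_of_chain_budget m _ (kOf m) s _ _ (qOf m) (epsOf c m) hq0 hq1 hhalf hε h2t hpos ?_
  have hV := card_smallSets_le_two_pow m ((2 * c + 8) * (Nat.log 2 m + 1))
  have hVR : (#(smallSets (Fin m) ((2 * c + 8) * (Nat.log 2 m + 1))) : ℝ) ≤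
      (2 : ℝ) ^ ((Nat.log 2 m + 1) * ((2 * c + 8) * (Nat.log 2 m + 1))) := by exact_mod_cast hV
  refine cover_budget_two_pow (a := (Nat.log 2 m + 1) * ((2 * c + 8) * (Nat.log 2 m + 1)) * (s * s))
    (Λ := Nat.log 2 m + 1) hm1 (by positivity) ?_ hVR ?_ hmΛ
  · calc (#(smallSets (Fin m) ((2 * c + 8) * (Nat.log 2 m + 1))) : ℝ) ^ (s * s)
        ≤ ((2 : ℝ) ^ ((Nat.log 2 m + 1) * ((2 * c + 8) * (Nat.log 2 m + 1)))) ^ (s * s) :=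
          pow_le_pow_left₀ (Nat.cast_nonneg _) hVR (s * s)
      _ = (2 : ℝ) ^ ((Nat.log 2 m + 1) * ((2 * c + 8) * (Nat.log 2 m + 1)) * (s * s)) := (pow_mul _ _ _).symm
  · have h1 : (Nat.log 2 m + 1) * ((2 * c + 8) * (Nat.log 2 m + 1)) * (s * s) +
        (Nat.log 2 m + 1) * ((2 * c + 8) * (Nat.log 2 m + 1)) =
        (Nat.log 2 m + 1) * ((2 * c + 8) * (Nat.log 2 m + 1)) * (s * s + 1) := by ring
    omega

/-! ### Unions of gate classes -/

/-- Term gates are monotone in the gate class. [folklore] -/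
theorem isTermGate_mono {m l : ℕ} {P Q : GateFn → Prop} (hPQ : ∀ g, P g → Q g) {O : (KEdge m → Bool) → Bool}
    (h : IsTermGate m P l O) : IsTermGate m Q l O := by
  obtain ⟨g, hg, X, hX, hOX⟩ := h
  exact ⟨g, hPQ g hg, X, hX, hOX⟩

/-- **The single-gate statement for a union of gate classes is the conjunction.** [folklore] -/
theorem sgAt_or {m l k : ℕ} {q ε : ℝ} {P Q : GateFn → Prop} (hP : SGAt m P l k q ε) (hQ : SGAt m Q l k q ε) :
    SGAt m (fun g => P g ∨ Q g) l k q ε := by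
  intro O hO
  obtain ⟨g, hg | hg, X, hX, hOX⟩ := hO
  · exact hP O ⟨g, hg, X, hX, hOX⟩
  · exact hQ O ⟨g, hg, X, hX, hOX⟩

/-! ### Unconditional circuit lower bounds with GRANK gates -/

/-- **No polynomial-size monotone circuit with generic-rank gates of dimension `s ≤ m^{7/16-o(1)}` computes
`CLIQUE(m, ⌈m^{1/8}⌉)` (unconditional; any fields, any constants).** For every `c`, eventually in `m`, for every `s` with
`s² ≤ m^{7/8}/(log₂ m)^5` and every circuit `C` over `{∧₂, ∨₂} ∪ GRANK_s` with `C.size ≤ m^c`: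
`¬ C.Computes CLIQUE(m, ⌈m^{1/8}⌉)`. Proof: the level-`l` door theorem at `l = L(c,m)` (`2c+8 ≤ L ≤ lOf m` by
`logWidth_le_lOf`) with `W = GRANK_s`, `P = IsGRankGate s`: GRANK gates are monotone (`IsGRankGate.monotone`), a `GRANK_s`
gate over small-clique DNFs collapses to a `GRANK_s` term gate (`stub_termCollapse`), and `sgAt_gRank_logWidth` is the
single-gate statement at width `L`. [folklore] -/
theorem not_computes_clique_of_isOver_gRank_logWidth : ∀ c : ℕ, ∀ᶠ m : ℕ in atTop, ∀ s : ℕ,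
    (s : ℝ) ^ 2 ≤ (m : ℝ) ^ (7 / 8 : ℝ) / Real.logb 2 m ^ 5 →
    ∀ C : Circuit (KEdge m), C.IsOver ({GateFn.and 2, GateFn.or 2} ∪ {g | IsGRankGate s g}) →
      C.size ≤ m ^ c → ¬ C.Computes (cliqueFn m ⌈(m : ℝ) ^ (1 / 8 : ℝ)⌉₊) := by
  intro c
  filter_upwards [not_computes_clique_of_collapse_level c, sgAt_gRank_logWidth c, logWidth_le_lOf c]
    with m hhost hSG hLl s hs C hC hsize
  exact hhost ((2 * c + 8) * (Nat.log 2 m + 1)) (Nat.le_mul_of_pos_right _ (Nat.succ_pos _)) hLl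
    {g | IsGRankGate s g} (IsGRankGate s) (fun g (hg : IsGRankGate s g) => hg.monotone)
    (fun g (hg : IsGRankGate s g) A hA => (stub_termCollapse m s _ g A hA).2 hg) (hSG s hs) C hC hsize

/-- **No polynomial-size monotone circuit over the crux's full wide basis `{∧₂, ∨₂} ∪ PERM_d ∪ GRANK_s` computes
`CLIQUE(m, ⌈m^{1/8}⌉)` when `d log₂ d ≤ m^{7/8}/(log₂ m)^5` and `s² ≤ m^{7/8}/(log₂ m)^5` (unconditional).** For every
`c`, eventually in `m`, for all such `d, s` and every circuit `C` over `{∧₂, ∨₂} ∪ {g | PERM_d g ∨ GRANK_s g}` with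
`C.size ≤ m^c`: `¬ C.Computes CLIQUE(m, ⌈m^{1/8}⌉)` — the door theorem with `W = PERM_d ∪ GRANK_s`, the collapse of either
kind (`stub_termCollapse`) and the conjunction `sgAt_or` of `sgAt_perm_logWidth` and `sgAt_gRank_logWidth`. [folklore] -/
theorem not_computes_clique_of_isOver_perm_gRank_logWidth : ∀ c : ℕ, ∀ᶠ m : ℕ in atTop, ∀ d s : ℕ,
    (d : ℝ) * Real.logb 2 d ≤ (m : ℝ) ^ (7 / 8 : ℝ) / Real.logb 2 m ^ 5 →
    (s : ℝ) ^ 2 ≤ (m : ℝ) ^ (7 / 8 : ℝ) / Real.logb 2 m ^ 5 →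
    ∀ C : Circuit (KEdge m), C.IsOver ({GateFn.and 2, GateFn.or 2} ∪ {g | IsPermGate d g ∨ IsGRankGate s g}) →
      C.size ≤ m ^ c → ¬ C.Computes (cliqueFn m ⌈(m : ℝ) ^ (1 / 8 : ℝ)⌉₊) := by
  intro c
  filter_upwards [not_computes_clique_of_collapse_level c, sgAt_perm_logWidth c, sgAt_gRank_logWidth c,
    logWidth_le_lOf c] with m hhost hSGp hSGg hLl d s hd hs C hC hsize
  refine hhost ((2 * c + 8) * (Nat.log 2 m + 1)) (Nat.le_mul_of_pos_right _ (Nat.succ_pos _)) hLl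
    {g | IsPermGate d g ∨ IsGRankGate s g} (fun g => IsPermGate d g ∨ IsGRankGate s g)
    (fun g (hg : IsPermGate d g ∨ IsGRankGate s g) => hg.elim IsPermGate.monotone IsGRankGate.monotone)
    (fun g (hg : IsPermGate d g ∨ IsGRankGate s g) A hA => hg.elim
      (fun h => isTermGate_mono (fun _ h' => Or.inl h') ((stub_termCollapse m d _ g A hA).1 h))
      (fun h => isTermGate_mono (fun _ h' => Or.inr h') ((stub_termCollapse m s _ g A hA).2 h)))
    (sgAt_or (hSGp d hd) (hSGg s hs)) C hC hsize

/-! ### The crux's own shape with a real gate exponent `γ < 7/16` -/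

/-- Eventually `(log₂ m)^k ≤ m^η` for every `k` and every `η > 0`. [folklore] -/
theorem eventually_logb_pow_le_rpow (k : ℕ) {η : ℝ} (hη : 0 < η) :
    ∀ᶠ m : ℕ in atTop, Real.logb 2 m ^ k ≤ (m : ℝ) ^ η := by
  have h := ((isLittleO_log_rpow_rpow_atTop (k : ℝ) hη).comp_tendsto tendsto_natCast_atTop_atTop).def
    (by positivity : (0 : ℝ) < 1 / 2 ^ k)
  filter_upwards [h] with m hm
  have hl0 : 0 ≤ Real.log m := Real.log_natCast_nonneg m
  have h1 : ‖Real.log m ^ (k : ℝ)‖ = Real.log m ^ k := by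
    rw [Real.rpow_natCast, Real.norm_of_nonneg (pow_nonneg hl0 k)]
  have h2 : ‖(m : ℝ) ^ η‖ = (m : ℝ) ^ η := Real.norm_of_nonneg (Real.rpow_nonneg (Nat.cast_nonneg m) _)
  simp only [Function.comp_def] at hm
  rw [h1, h2] at hm
  have hlb : Real.logb 2 m ≤ 2 * Real.log m := logb_two_le_two_mul_log m
  have h2k : (0 : ℝ) < 2 ^ k := by positivity
  calc Real.logb 2 m ^ k ≤ (2 * Real.log m) ^ k := pow_le_pow_left₀ (logb_two_nonneg m) hlb k
    _ = 2 ^ k * Real.log m ^ k := by rw [mul_pow]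
    _ ≤ 2 ^ k * (1 / 2 ^ k * (m : ℝ) ^ η) := mul_le_mul_of_nonneg_left hm h2k.le
    _ = (m : ℝ) ^ η := by field_simp

/-- `d · log₂ d ≤ d²` for every natural `d` (`log₂ d < d`, i.e. `d < 2^d`). [folklore] -/
theorem natCast_mul_logb_le_sq (d : ℕ) : (d : ℝ) * Real.logb 2 d ≤ (d : ℝ) ^ 2 := by
  rcases Nat.eq_zero_or_pos d with rfl | hd
  · simp
  · have hd0 : (0 : ℝ) < d := by exact_mod_cast hd
    have hlt : Real.logb 2 d < d := by
      rw [Real.logb_lt_iff_lt_rpow one_lt_two hd0, Real.rpow_natCast]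
      exact_mod_cast Nat.lt_two_pow_self
    rw [sq]
    exact mul_le_mul_of_nonneg_left hlt.le hd0.le

/-- **The crux with a real gate exponent: `{∧₂, ∨₂} ∪ PERM_{⌊m^γ⌋} ∪ GRANK_{⌊m^γ⌋}`-circuits of polynomial size are
blind to `CLIQUE(m, ⌈m^{1/8}⌉)` for every `γ < 7/16` (unconditional).** For every `c` and every real `γ < 7/16`,
eventually in `m`, for every circuit `C` over `{∧₂, ∨₂} ∪ {g | PERM_{⌊m^γ⌋₊} g ∨ GRANK_{⌊m^γ⌋₊} g}` with `C.size ≤ m^c`: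
`¬ C.Computes CLIQUE(m, ⌈m^{1/8}⌉)`. (`s = ⌊m^γ⌋`: `s² ≤ m^{2γ} ≤ m^{7/8}/(log₂ m)^5` as `2γ < 7/8`, and
`s log₂ s ≤ s²`.) The crux `LinAlgGateBlind` is this statement with `⌊m^γ⌋` replaced by `m^c` for every natural `c`.
[folklore] -/
theorem not_computes_clique_of_isOver_lin_rpow : ∀ (c : ℕ) (γ : ℝ), γ < 7 / 16 → ∀ᶠ m : ℕ in atTop,
    ∀ C : Circuit (KEdge m),
      C.IsOver ({GateFn.and 2, GateFn.or 2} ∪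
        {g | IsPermGate ⌊(m : ℝ) ^ γ⌋₊ g ∨ IsGRankGate ⌊(m : ℝ) ^ γ⌋₊ g}) →
      C.size ≤ m ^ c → ¬ C.Computes (cliqueFn m ⌈(m : ℝ) ^ (1 / 8 : ℝ)⌉₊) := by
  intro c γ hγ
  have hη : 0 < 7 / 8 - 2 * γ := by linarith
  filter_upwards [not_computes_clique_of_isOver_perm_gRank_logWidth c, eventually_logb_pow_le_rpow 5 hη,
    eventually_ge_atTop 3] with m hm hlog hm3 C hC hsize
  have hmpos : (0 : ℝ) < m := by exact_mod_cast (show 0 < m by omega)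
  have hℓ1 : 1 ≤ Real.logb 2 m := (one_le_log hm3).trans (log_le_logb_two m)
  have hℓ5 : 0 < Real.logb 2 m ^ 5 := by positivity
  have h0 : (0 : ℝ) ≤ (m : ℝ) ^ γ := Real.rpow_nonneg (Nat.cast_nonneg m) _
  have hs2 : ((⌊(m : ℝ) ^ γ⌋₊ : ℕ) : ℝ) ^ 2 ≤ (m : ℝ) ^ (7 / 8 : ℝ) / Real.logb 2 m ^ 5 := by
    rw [le_div_iff₀ hℓ5]
    calc ((⌊(m : ℝ) ^ γ⌋₊ : ℕ) : ℝ) ^ 2 * Real.logb 2 m ^ 5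
        ≤ ((m : ℝ) ^ γ) ^ 2 * (m : ℝ) ^ (7 / 8 - 2 * γ) :=
          mul_le_mul (pow_le_pow_left₀ (Nat.cast_nonneg _) (Nat.floor_le h0) 2) hlog hℓ5.le (by positivity)
      _ = (m : ℝ) ^ (7 / 8 : ℝ) := by
          rw [← Real.rpow_natCast, ← Real.rpow_mul hmpos.le, ← Real.rpow_add hmpos]
          norm_num
          ring_nf
  exact hm _ _ ((natCast_mul_logb_le_sq _).trans hs2) hs2 C hC hsize

end Summit.PneNP.PneNP.Theorems

end
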